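import Summits.BirchSwinnertonDyer.BirchSwinnertonDyer.Theorems.GenusKolyvaginAtTwoShaCardDvdPowAtTwoPosTSharpExponentRatOfRegularPairSupply
import Summits.BirchSwinnertonDyer.BirchSwinnertonDyer.Theorems.GenusKolyvaginAtTwoShaCardDvdPowAtTwoPosTB2QSignFree
import Summits.BirchSwinnertonDyer.BirchSwinnertonDyer.Theorems.GenusKolyvaginAtTwoOffCutResidualAtTwoRLw2FlatSharpExponentRat
import HarnessLib

/-!
# Route `GenusKolyvaginAtTwo`, LINE 26 «lw2_phantom_exclusion» of the residual crux `OffCutResidualAtTwoR` (stmt-BirchSwinnertonDyer-31767):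
# the FLAT re-thread — part F: **Kolyvagin's Theorem B₂ over `ℚ`, SIGN-FREE frame (Δ>0 side), from `(NPh at 2N)` instead of an odd multiplicative prime**

Seat `bsd-line-gk2-p5` g40 (WIDTH-5 attach, cell `bsd-f1-sign2`), `--supports stmt-BirchSwinnertonDyer-31767` (helper; closes nothing).
THEOREMS ONLY (no definition, no named fact, no `sorry`).  **BSD is NOT proved by any of this**; the residual crux is NOT closed by it.

WHY.  LINE 26 (`Cruxes/OffCutResidualAtTwoR/Lines/lw2_phantom_exclusion.lean`, stubs `stub_Q3flat` / `stub_Q4flat`) asks for the LANDED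
exactness theorems Q3R_T (`…Theorems.equivariantKolyvaginExactAtTwoRT_proof`) and Q4_T″ (`…Theorems.kolyvaginExactAtTwoPosDiscT_proof`) with
their binder quadruple `(v) (h2v : 2 ∉ v) (hNv : N ∈ v) (hmult : E multiplicative at v)` REPLACED by the hypothesis it was only ever used to
derive (critic #471 P1 census, card §7: 10 entry points, 36 pass-through signatures, 0 other uses of `v`):
`(NPh at 2N)(E, K)` := «for every `M ≥ 1`, a class of `H¹(K, E[2^M])` that dies on `Γ_(K(E[2^M]))` and is Kummer at every place over `2N`
is `0`» — VERBATIM the conclusion of `GenusExact.NonPhantomPow.nonPhantomAtTwo_of_hasMultiplicativeReductionAt` (with `N := N_E`).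
Proofs below are the landed ones VERBATIM except that (i) the binder quadruple is gone and `hNPh` is inserted right after the two
`¬ IsSquare` clauses (where `K` is in scope), (ii) at the entry points the local `(NPh_M)` is read off `hNPh` instead of the multiplicative
prime, (iii) callees are the `_flat` siblings.  Decl names = originals + `_flat`; namespaces unchanged.

WHAT (this part).  The Δ>0 (B2Q⁺) entry point of the Q4_T″ cone: gk2-p5 g31's `two_pow_smul_selmer_rat_eq_zero_of_regularPairSupply` (Kolyvagin's Theorem B₂
at `l = 2` over `ℚ`, sharp, sign-free frame with a regular-pair supply) and its corollary `stub_b2qSignFree` (the registered (B2Q) stub of U⁺_T,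
sign-free).  Imports the landed part A2 (`…Lw2FlatSharpExponentRat`, p780851).

References: [GrossLMS1991] §1, §5, §10; [Kolyvagin1990] Thm. A; [McCallumLMS1991] §1, §3, §5; [Kramer1981] Thm. 1; [LawsonWuthrich2016] §4, §8
(the level-2 phantom class that supplies `(NPh at 2N)` off the cut — LINE 26 stubs `stub_KLW` / `stub_transport`, other seats).
-/

set_option autoImplicit false
-- the Theorems namespace of this sub repeats the summit name by design (D-0017 nested layout)
set_option linter.dupNamespace false

noncomputable section

/-! ## from `GenusKolyvaginAtTwoShaCardDvdPowAtTwoPosTSharpExponentRatOfRegularPairSupply` -/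

open scoped Classical
open scoped AddSubgroup

namespace Summit.BirchSwinnertonDyer.BirchSwinnertonDyer.Theorems.GenusExact.PlusDescent

open WeierstrassCurve NumberField IsDedekindDomain Field Rat.HeightOneSpectrum Literature.NumberTheory.EllipticCurves
  Literature.NumberTheory.GaloisRepresentations Literature.NumberTheory.EllipticCurves.ModularForms AddSubgroup
  Literature.NumberTheory.EllipticCurves.RingClassField
open Summit.BirchSwinnertonDyer.BirchSwinnertonDyer.Theses.GenusKolyvaginAtTwo (KolyvaginRelationAtTwo)
open Summit.BirchSwinnertonDyer.Rank1Residual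
open Summit.BirchSwinnertonDyer.BirchSwinnertonDyer.Theorems.GenusExact
open Summit.BirchSwinnertonDyer.BirchSwinnertonDyer.Theorems.GenusExact.VisiblePairAtTwo
  (liesOver_of_natCast_mem natCast_mem_primesEquiv_symm natCast_prime_mem_iff_eq hasGoodReductionAt_of_hasGoodReductionAtPrime
    not_mem_range intCast_notMem_of_not_dvd)
open Summit.BirchSwinnertonDyer.BirchSwinnertonDyer.Theorems.OffBigImageOddLocalAtTwo

/-- (LINE 26 FLAT form: the hypothesis `(NPh at 2N)(E, K)` replaces the odd multiplicative prime `v`.) **(B2Q±) Kolyvagin's Theorem B₂ at `l = 2` over `ℚ`, SHARP, for EITHER SIGN of `Δ(E)`, modulo the regular signed pair-Čebotarev supply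
`hPair`: `2^{M₀} • s = 0` for every `s ∈ Sel_(2^M)(E/ℚ)`, every `M`** (modulo Q2; `w(E) = +1`).  See the module docstring.  On `Δ < 0` this is
g22's `two_pow_smul_selmer_rat_eq_zero_onHabitat_flat` (there `hPair` holds with `h = c₀`); on `Δ > 0` it is (B2Q⁺) reduced to `hPair`.
(Proof adapted from `…RTSharpExponentRat.two_pow_smul_selmer_rat_eq_zero_onHabitat_flat`, gk2-p4 g22.)
[cite: Kolyvagin1989Izv, Thm. B₂, §3] [cite: McCallumLMS1991, §3 Cor. 3.2, §4 Prop. 4.4, §5 Lemma 5.3] [cite: GrossLMS1991, §10, Props. 5.4, 6.2, 8.2] -/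
theorem two_pow_smul_selmer_rat_eq_zero_of_regularPairSupply_flat (hQ2 : KolyvaginRelationAtTwo)
    (W : WeierstrassCurve ℚ) [W.IsElliptic] [W.IsGloballyMinimal] [NeZero (W.conductorNorm ℤ)] (hcm : ¬ W.HasCM)
    (hT : Odd W.tamagawaProduct)
    (K : Type) [Field K] [NumberField K] (hIQ : IsImaginaryQuadratic K) (hodd : Odd (NumberField.discr K))
    (h3 : NumberField.discr K ≠ -3) (hHe : SatisfiesHeegnerHypothesis (W.conductorNorm ℤ) K)
    (_hsq1 : ¬ IsSquare ((NumberField.discr K : ℚ) * -|W.Δ|)) (_hsq2 : ¬ IsSquare ((NumberField.discr K : ℚ) * (-(2 * |W.Δ|))))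
    (hNPh : ∀ (Mlev : ℕ), 1 ≤ Mlev → ∀ z : galH1Torsion (W.baseChange K) ((2 ^ Mlev : ℕ) : ℤ),
      (∀ ρ ∈ torsionFixing (W.baseChange K) ((2 ^ Mlev : ℕ) : ℤ), h1Eval (W.baseChange K) ((2 ^ Mlev : ℕ) : ℤ) z ρ = 0) →
      (∀ w : HeightOneSpectrum (𝓞 K), ((2 * W.conductorNorm ℤ : ℕ) : 𝓞 K) ∈ w.asIdeal →
        z ∈ selmerLocalKer (W.baseChange K) (w.adicCompletion K) ((2 ^ Mlev : ℕ) : ℤ)) → z = 0)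
    (hρ : ∀ n : ℕ, 0 < n → W.HasSurjectiveModNGaloisRep ((2 : ℤ) ^ n))
    (Dt : ModularParametrizationData W (W.conductorNorm ℤ)) (β : ℤ) (ι : K →+* ℂ) (d₁ : KolyvaginHeegnerData Dt β ι 1) (M₀ : ℕ)
    (hndiv : ¬ ∃ Q : (W.baseChange (ringClassField K ι 1)).toAffine.Point, ((2 ^ (M₀ + 1) : ℕ) : ℤ) • Q = d₁.derivedPoint)
    (hw1 : W.rootNumber = 1)
    (hPair : ∀ (n : ℕ) (c : K ≃ₐ[ℚ] K), c ≠ 1 →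
      ∀ (x y : galH1Torsion (W.baseChange K) ((2 ^ (n + 1) : ℕ) : ℤ)) (ex ey : ℕ), 1 ≤ ex → 1 ≤ ey →
      addOrderOf x = 2 ^ ex → addOrderOf y = 2 ^ ey →
      ∀ (sx sy : ℤ), (sx = 1 ∨ sx = -1) → (sy = 1 ∨ sy = -1) →
      conjAct W c ((2 ^ (n + 1) : ℕ) : ℤ) x = sx • x → conjAct W c ((2 ^ (n + 1) : ℕ) : ℤ) y = sy • y →
      (∀ a b : ℤ, (∀ ρ ∈ torsionFixing (W.baseChange K) ((2 ^ (n + 1) : ℕ) : ℤ),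
          h1Eval (W.baseChange K) ((2 ^ (n + 1) : ℕ) : ℤ) (a • x + b • y) ρ = 0) → a • x + b • y = 0) →
      ∃ ℓ : ℕ, Zhang2014.IsKolyvaginPrime (W.conductorNorm ℤ) W K 2 ℓ ∧ n + 1 ≤ Zhang2014.kolyvaginIndex W 2 ℓ ∧
        (∃ (v : HeightOneSpectrum (𝓞 ℚ)) (𝔓 : Ideal (absIntegers (𝓞 ℚ) ℚ)) (h c₀ : absoluteGaloisGroup ℚ),
          (ℓ : 𝓞 ℚ) ∈ v.asIdeal ∧ 𝔓 ∈ v.primesAbove ∧ IsArithFrobAt (𝓞 ℚ) h 𝔓 ∧ IsComplexConjugation (Rat.castHom ℝ) c₀ ∧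
          (∀ X : geomTorsion W ((2 ^ (n + 1) : ℕ) : ℤ), h • h • X = X) ∧
          (∃ u : geomTorsion W ((2 : ℕ) : ℤ), h • u ≠ u) ∧
          ∀ (e : K →ₐ[ℚ] AlgebraicClosure ℚ) (z : K), h • e z = c₀ • e z) ∧
        ∀ w : HeightOneSpectrum (𝓞 K), (ℓ : 𝓞 K) ∈ w.asIdeal →
          (∀ j : ℕ, ((2 ^ j : ℕ) : ℤ) • x ∈ (W.baseChange K).torsionLocalKer (w.adicCompletion K) ((2 ^ (n + 1) : ℕ) : ℤ) ↔ ex ≤ j) ∧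
          (∀ j : ℕ, ((2 ^ j : ℕ) : ℤ) • y ∈ (W.baseChange K).torsionLocalKer (w.adicCompletion K) ((2 ^ (n + 1) : ℕ) : ℤ) ↔ ey ≤ j))
    (M : ℕ) (s₀ : galH1Torsion W ((2 ^ M : ℕ) : ℤ)) (hs₀ : s₀ ∈ selmerGroup W ((2 ^ M : ℕ) : ℤ)) :
    ((2 ^ M₀ : ℕ) : ℤ) • s₀ = 0 := by
  haveI : Fact (Nat.Prime 2) := ⟨Nat.prime_two⟩
  haveI : ∀ j : ℕ, NumberField (ringClassField K ι j) := JET.numberField_ringClassField K hIQ ι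
  haveI hell : (W.baseChange K).IsElliptic := inferInstanceAs ((W.map (algebraMap ℚ K)).IsElliptic)
  -- ### the trivial range `M ≤ M₀`
  by_cases hMM₀ : M ≤ M₀
  · obtain ⟨e, he⟩ := Nat.exists_eq_add_of_le hMM₀
    have h0 : ((2 ^ M : ℕ) : ℤ) • s₀ = 0 := zsmul_discreteH1_torsion _ s₀
    have hpow : ((2 ^ M₀ : ℕ) : ℤ) = ((2 ^ e : ℕ) : ℤ) * ((2 ^ M : ℕ) : ℤ) := by
      rw [he, pow_add]; push_cast; ring
    rw [hpow, mul_smul, h0, zsmul_zero]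
  have hM₀M : M₀ + 1 ≤ M := by omega
  have hM : 1 ≤ M := le_trans (Nat.le_add_left 1 M₀) hM₀M
  have hM' : 1 ≤ M + 1 := by omega
  -- ### numerics and currencies
  have hsurN : ∀ m : ℕ, W.HasSurjectiveModNGaloisRep ((2 ^ m : ℕ) : ℤ) :=
    MinimalTwinBSDTwo.forall_hasSurjectiveModNGaloisRep_two_pow_of_pos W hρ
  have hρN : ∀ m : ℕ, W.HasSurjectiveModNGaloisRep (2 ^ m : ℕ) := fun m ↦ by exact_mod_cast hsurN m
  have hsurj1 : W.HasSurjectiveModNGaloisRep ((2 : ℤ) ^ 1) := hρ 1 one_pos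
  have hs2 : W.HasSurjectiveModNGaloisRep 2 := by simpa using hsurj1
  have h2 : Module.finrank ℚ K = 2 := hIQ.1
  have hD4 : NumberField.discr K ≠ -4 := fun h ↦ by
    rw [h] at hodd; exact (Int.not_even_iff_odd.mpr hodd) ⟨-2, by norm_num⟩
  have hD : NumberField.discr K < -4 := X11b.KolyvaginAssembly.discr_lt_neg_four hIQ ⟨h3, hD4⟩
  -- the complex conjugation `τ = σ_θ`, `θ² = d_K`
  obtain ⟨θ, hθ, hd⟩ := Literature.NumberTheory.QuadraticFields.Quadratic.exists_not_mem_range_sq_eq_discr (K := K) h2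
  set τ : K ≃ₐ[ℚ] K := sigmaQ K h2 hθ hd with hτdef
  have hτ : τ ≠ 1 := sigmaQ_ne_one K h2 hθ hd
  -- ### no `2`-power torsion in `E(K)`
  have htorsK : ∀ (m : ℕ) (P : (W.baseChange K).toAffine.Point), ((2 ^ m : ℕ) : ℤ) • P = 0 → P = 0 := fun m P hP ↦
    EigenClassesFinite.forall_zsmul_two_pow_baseChange_eq_zero_of_hasSurjectiveModNGaloisRep_two W K h2 hs2 m P
      (by exact_mod_cast hP)
  -- ### (NPh) at every level from the hypothesis `(NPh at 2N)` (all-places form)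
  have hNPh : ∀ (L : ℕ), 1 ≤ L → ∀ z : galH1Torsion (W.baseChange K) ((2 ^ L : ℕ) : ℤ),
      (∀ ρ' ∈ torsionFixing (W.baseChange K) ((2 ^ L : ℕ) : ℤ), h1Eval (W.baseChange K) ((2 ^ L : ℕ) : ℤ) z ρ' = 0) →
      (∀ w : HeightOneSpectrum (𝓞 K), z ∈ selmerLocalKer (W.baseChange K) (w.adicCompletion K) ((2 ^ L : ℕ) : ℤ)) → z = 0 :=
    fun L hL z hz hzS ↦ hNPh L hL z hz (fun w _ ↦ hzS w)
  -- ### the Selmer class over `K`: `s = res s₀`, `τ`-invariant, same order `2^a`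
  set s := resTorsion W K ((2 ^ M : ℕ) : ℤ) s₀ with hsdef
  have hsSel : s ∈ selmerGroup (W.baseChange K) ((2 ^ M : ℕ) : ℤ) := resTorsion_mem_selmerGroup W K ((2 ^ M : ℕ) : ℤ) hs₀
  have hinjres : Function.Injective (resTorsion W K ((2 ^ M : ℕ) : ℤ)) :=
    EigenClassesFinite.resTorsion_injective_of_noTorsion W K h2 hθ hd ((2 ^ M : ℕ) : ℤ) (htorsK M)
  have hτs : conjAct W τ ((2 ^ M : ℕ) : ℤ) s = s :=
    (EigenClassesFinite.mem_range_resTorsion_iff_conjAct_eq W K h2 hθ hd ((2 ^ M : ℕ) : ℤ) (htorsK M) s).mp ⟨s₀, rfl⟩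
  obtain ⟨a, haM, ha⟩ := exists_addOrderOf_galH1Torsion_eq_two_pow W K M s
  by_cases ha0 : a = 0
  · -- `s = 0`, hence `s₀ = 0`
    have hs0 : s = 0 := AddMonoid.addOrderOf_eq_one_iff.mp (by rw [ha, ha0, pow_zero])
    have : s₀ = 0 := hinjres (by rw [← hsdef, hs0, map_zero])
    rw [this, zsmul_zero]
  have ha1 : 1 ≤ a := Nat.one_le_iff_ne_zero.mpr ha0
  -- ### the Heegner class `y = c_M(1) = δ Ph`, order `2^κ`, `κ ≥ M − M₀`, sign `−1`
  have hdiv : ∀ P : geomPoints (W.baseChange K), ∃ Q : geomPoints (W.baseChange K), ((2 ^ M : ℕ) : ℤ) • Q = P :=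
    (W.baseChange K).zsmul_geomPoints_surjective_of_charZero (by positivity)
  set δ := kummerMapTorsion (W.baseChange K) ((2 ^ M : ℕ) : ℤ) hdiv with hδ
  have hker : δ.ker = (zsmulAddGroupHom (α := (W.baseChange K).toAffine.Point) ((2 ^ M : ℕ) : ℤ)).range := kummerMapTorsion_ker (W.baseChange K) ((2 ^ M : ℕ) : ℤ) hdiv
  obtain ⟨Ph, hPh, hPhmap⟩ := AdditiveKoly.exists_isHeegnerPoint_map_eq_derivedPoint_one (W := W) (K := K) (Dt := Dt) (β := β)
    (ι := ι) hIQ hHe d₁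
  set y := d₁.kolyvaginClass Nat.prime_two M with hydef
  have hc1 : y = δ Ph := VisiblePairAtTwo.kolyvaginClass_one_two_eq_kummerMapTorsion W K hIQ hodd hHe hsurj1 M d₁ Ph hPhmap
  have hP₀ : ∀ Q : (W.baseChange K).toAffine.Point, ((2 ^ (M₀ + 1) : ℕ) : ℤ) • Q ≠ Ph :=
    forall_two_pow_smul_ne_bottom_of_not_dvd_derivedPoint d₁ Ph hPhmap le_rfl hndiv
  obtain ⟨κ, hκM, hκ⟩ := exists_addOrderOf_galH1Torsion_eq_two_pow W K M y
  have hκge : M - M₀ ≤ κ := by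
    by_contra hlt'
    have h0 : ((2 ^ κ : ℕ) : ℤ) • y = 0 := (two_pow_zsmul_eq_zero_iff_of_addOrderOf W K hκ κ).mpr le_rfl
    have hmem : ((2 ^ κ : ℕ) : ℤ) • Ph ∈ δ.ker := by rw [AddMonoidHom.mem_ker, map_zsmul, ← hc1, h0]
    rw [hker] at hmem
    obtain ⟨R, hR⟩ := hmem
    have hPhR : Ph = ((2 ^ (M - κ) : ℕ) : ℤ) • R := eq_two_pow_zsmul_of_two_pow_zsmul_eq (htorsK 1 · <| by simpa using ·) hκM hR
    refine hP₀ (((2 ^ (M - κ - (M₀ + 1)) : ℕ) : ℤ) • R) ?_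
    rw [hPhR, smul_smul]
    congr 1
    push_cast
    rw [← pow_add]
    congr 1
    omega
  have hκ1 : 1 ≤ κ := by omega
  have h1K : ∀ q ∈ (1 : ℕ).primeFactors, Zhang2014.IsKolyvaginPrime (W.conductorNorm ℤ) W K 2 q ∧ M ≤ Zhang2014.kolyvaginIndex W 2 q := by
    simp
  obtain ⟨-, hτy⟩ := KolyvaginClassSign.sign_conjAct_kolyvaginClass_two hIQ h3 hD4 hodd hHe hsurj1 τ hτ Dt β ι squarefree_one hM h1K d₁
  rw [Nat.primeFactors_one, Finset.card_empty, pow_zero, mul_one, hw1] at hτy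
  -- ### ONE LEVEL UP: `ι_* s`, `ι_* y` at level `2^(M+1)`
  have hdvd : ((2 ^ M : ℕ) : ℤ) ∣ ((2 ^ (M + 1) : ℕ) : ℤ) := KolyvaginPairDataTwo.two_pow_dvd_two_pow_succ M
  set ιM := torsionH1OfDvd (W.baseChange K) hdvd with hιM
  have hιinj : Function.Injective ιM := KolyvaginPairDataTwo.torsionH1OfDvd_succ_injective W M hIQ hs2
  have hsSel' : ιM s ∈ selmerGroup (W.baseChange K) ((2 ^ (M + 1) : ℕ) : ℤ) := torsionH1OfDvd_mem_selmerGroup (W.baseChange K) hdvd hsSel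
  have hySel : y ∈ selmerGroup (W.baseChange K) ((2 ^ M : ℕ) : ℤ) := by
    rw [hc1]; exact WeierstrassCurve.kummerMapTorsion_mem_selmerGroup (W.baseChange K) _ hdiv Ph
  have hySel' : ιM y ∈ selmerGroup (W.baseChange K) ((2 ^ (M + 1) : ℕ) : ℤ) := torsionH1OfDvd_mem_selmerGroup (W.baseChange K) hdvd hySel
  have hords' : addOrderOf (ιM s) = 2 ^ a := by rw [addOrderOf_injective ιM hιinj, ha]
  have hordy' : addOrderOf (ιM y) = 2 ^ κ := by rw [addOrderOf_injective ιM hιinj, hκ]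
  have hτs' : conjAct W τ ((2 ^ (M + 1) : ℕ) : ℤ) (ιM s) = (1 : ℤ) • ιM s := by
    rw [one_zsmul, hιM, conjAct_torsionH1OfDvd W τ hdvd s, hτs]
  have hτy' : conjAct W τ ((2 ^ (M + 1) : ℕ) : ℤ) (ιM y) = (-1 : ℤ) • ιM y := by
    rw [hιM, conjAct_torsionH1OfDvd W τ hdvd y, hτy, map_zsmul]
  -- separation for the pair from (NPh_{M+1}): both classes are Selmer
  have hres : ∀ a' b' : ℤ, (∀ ρ' ∈ torsionFixing (W.baseChange K) ((2 ^ (M + 1) : ℕ) : ℤ), h1Eval (W.baseChange K) ((2 ^ (M + 1) : ℕ) : ℤ) (a' • ιM s + b' • ιM y) ρ' = 0) →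
      a' • ιM s + b' • ιM y = 0 := by
    intro a' b' hab
    have hmem : a' • ιM s + b' • ιM y ∈ selmerGroup (W.baseChange K) ((2 ^ (M + 1) : ℕ) : ℤ) :=
      add_mem (AddSubgroup.zsmul_mem _ hsSel' a') (AddSubgroup.zsmul_mem _ hySel' b')
    exact hNPh (M + 1) hM' _ hab (fun w ↦ (((W.baseChange K).mem_selmerGroup_iff _ _).mp hmem).1 w)
  -- ### the REGULAR Kolyvagin prime from the displayed supply `hPair` (level `2^(M+1)`, signs `(+1, −1)`)
  obtain ⟨ℓ, hkolZ, hidx', hfrob, hloc'⟩ := hPair M τ hτ (ιM s) (ιM y) a κ ha1 hκ1 hords' hordy' 1 (-1) (Or.inl rfl)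
    (Or.inr rfl) hτs' hτy' hres
  obtain ⟨hℓp, hℓN, hℓdK, hℓ2, hℓprime, hidxpos⟩ := hkolZ
  haveI : Fact ℓ.Prime := ⟨hℓp⟩
  have hkolZ : Zhang2014.IsKolyvaginPrime (W.conductorNorm ℤ) W K 2 ℓ := ⟨hℓp, hℓN, hℓdK, hℓ2, hℓprime, hidxpos⟩
  obtain ⟨vP, 𝔓, hfr, c₀, hℓvP, h𝔓, hhfr, hc₀, hhsq, hhu, hhK⟩ := hfrob
  -- the place `λ = (ℓ)` of `K`
  set w : HeightOneSpectrum (𝓞 K) := ⟨Ideal.span {(ℓ : 𝓞 K)}, hℓprime, by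
    rw [Ne, Ideal.span_singleton_eq_bot]; exact_mod_cast hℓp.ne_zero⟩ with hwdef
  have hwℓ : (ℓ : 𝓞 K) ∈ w.asIdeal := Ideal.mem_span_singleton_self _
  -- the rational place `v_ℓ` and its local data
  set vℓ : HeightOneSpectrum (𝓞 ℚ) := primesEquiv.symm ⟨ℓ, hℓp⟩ with hvℓdef
  have hℓv : (ℓ : 𝓞 ℚ) ∈ vℓ.asIdeal := natCast_mem_primesEquiv_symm hℓp
  have hvPℓ : vP = vℓ := (natCast_prime_mem_iff_eq hℓp vP).mp hℓvP
  obtain ⟨h2vℓ, hqv⟩ := SelmerDescent.two_notMem_and_natCast_two_pow_notMem (rfl : 2 ^ M = 2 ^ M) hℓp hℓ2 hℓv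
  have hdKv : ((NumberField.discr K : ℤ) : 𝓞 ℚ) ∉ vℓ.asIdeal := intCast_notMem_of_not_dvd hℓp hℓv hℓdK
  haveI hLO : w.asIdeal.LiesOver vℓ.asIdeal := liesOver_of_natCast_mem hℓp hℓv hwℓ
  have hgood : W.HasGoodReductionAtPrime ℓ := hasGoodReductionAtPrime_of_not_dvd_conductorNorm W hℓN
  have hgoodv : W.HasGoodReductionAt vℓ := hasGoodReductionAt_of_hasGoodReductionAtPrime W hgood hℓv
  have hgoodK : (W.baseChange K).HasGoodReductionAt w := Engine.hasGoodReductionAt_baseChange_of_rat W hℓp hℓv hgoodv hwℓ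
  have hf : w.asIdeal.inertiaDeg (𝓞 ℚ) = 2 :=
    Summit.BirchSwinnertonDyer.Rank1Residual.X11b.Three.Koly.Method2.LocalFrob.inertiaDeg_eq_two_of_isPrime_span K h2 hℓp hℓprime w hwℓ
  -- the regular Frobenius datum in the three consumer shapes
  have hfrob' : ∃ (v' : HeightOneSpectrum (𝓞 ℚ)) (𝔓' : Ideal (absIntegers (𝓞 ℚ) ℚ)) (h' : absoluteGaloisGroup ℚ),
      (ℓ : 𝓞 ℚ) ∈ v'.asIdeal ∧ 𝔓' ∈ v'.primesAbove ∧ IsArithFrobAt (𝓞 ℚ) h' 𝔓' ∧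
      (∀ P : geomTorsion W ((2 ^ (M + 1) : ℕ) : ℤ), h' • P = hfr • P) ∧
      ∀ (e : K →ₐ[ℚ] AlgebraicClosure ℚ) (z : K), h' • e z = c₀ • e z :=
    ⟨vP, 𝔓, hfr, hℓvP, h𝔓, hhfr, fun _ ↦ rfl, hhK⟩
  have h𝔓ℓ : 𝔓 ∈ vℓ.primesAbove := hvPℓ ▸ h𝔓
  have hreg2 : ∃ (𝔓' : Ideal (absIntegers (𝓞 ℚ) ℚ)) (h' : absoluteGaloisGroup ℚ), 𝔓' ∈ vℓ.primesAbove ∧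
      IsArithFrobAt (𝓞 ℚ) h' 𝔓' ∧ (∀ P : geomTorsion W ((2 : ℕ) : ℤ), h' • h' • P = P) ∧
      ∃ u : geomTorsion W ((2 : ℕ) : ℤ), h' • u ≠ u :=
    ⟨𝔓, hfr, h𝔓ℓ, hhfr, smul_smul_eq_self_of_dvd W (by exact_mod_cast dvd_pow_self 2 (Nat.succ_ne_zero M)) hhsq, hhu⟩
  have hregM : ∃ (𝔓' : Ideal (absIntegers (𝓞 ℚ) ℚ)) (h' : absoluteGaloisGroup ℚ), 𝔓' ∈ vℓ.primesAbove ∧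
      IsArithFrobAt (𝓞 ℚ) h' 𝔓' ∧ (∀ X : geomTorsion W ((2 ^ M : ℕ) : ℤ), h' • h' • X = X) ∧
      ∃ u : geomTorsion W 2, h' • u ≠ u :=
    ⟨𝔓, hfr, h𝔓ℓ, hhfr, smul_smul_eq_self_of_dvd W hdvd hhsq, exists_smul_ne_two_of_natCast W hhu⟩
  -- ### full local orders at `λ`, transferred back to level `2^M` (`Γ_{K_λ}` fixes `E[2^(M+1)]`)
  obtain ⟨hαs', hαy'⟩ := hloc' w hwℓ
  have hmw : ((((2 ^ (M + 1) : ℕ) : ℕ) : ℤ) : 𝓞 K) ∉ w.asIdeal := fun hm ↦ by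
    apply not_natCast_mem_of_prime_ne hℓp Nat.prime_two hℓ2 w hwℓ
    rw [Int.cast_natCast, Nat.cast_pow] at hm
    exact w.isPrime.mem_of_pow_mem _ hm
  haveI : NeZero (2 ^ (M + 1)) := ⟨pow_ne_zero _ two_ne_zero⟩
  have htriv : ∀ (g : absoluteGaloisGroup (w.adicCompletion K)) (Q : geomTorsion (W.baseChange K) ((2 ^ (M + 1) : ℕ) : ℤ)),
      resGal (K := K) (w.adicCompletion K) g • Q = Q := fun g Q ↦
    Engine.absGaloisRestrict_smul_geomTorsion_eq_regular W hIQ hc₀ hhsq hℓp hℓprime hfrob' hwℓ hgoodK hmw g Q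
  have htrans : ∀ x : galH1Torsion (W.baseChange K) ((2 ^ M : ℕ) : ℤ), x ∈ (W.baseChange K).torsionLocalKer (w.adicCompletion K) ((2 ^ M : ℕ) : ℤ) ↔
      ιM x ∈ (W.baseChange K).torsionLocalKer (w.adicCompletion K) ((2 ^ (M + 1) : ℕ) : ℤ) := fun x ↦
    mem_torsionLocalKer_iff_torsionH1OfDvd_mem (W.baseChange K) (w.adicCompletion K) (pow_dvd_pow 2 (Nat.le_succ M))
      (pow_ne_zero _ two_ne_zero) (pow_ne_zero _ two_ne_zero) htriv x
  have hαs : ∀ j : ℕ, ((2 ^ j : ℕ) : ℤ) • s ∈ (W.baseChange K).torsionLocalKer (w.adicCompletion K) ((2 ^ M : ℕ) : ℤ) ↔ a ≤ j := fun j ↦ by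
    rw [htrans, map_zsmul]; exact hαs' j
  have hαy : ∀ j : ℕ, ((2 ^ j : ℕ) : ℤ) • y ∈ (W.baseChange K).torsionLocalKer (w.adicCompletion K) ((2 ^ M : ℕ) : ℤ) ↔ κ ≤ j := fun j ↦ by
    rw [htrans, map_zsmul]; exact hαy' j
  -- ### the datum at conductor `ℓ` compatible with `d₁`, its class `x = c_M(ℓ)` (sign `+1`) and Q2 at `λ`
  obtain ⟨dℓ, hdℓ⟩ := JET.exists_compatible_data_of_grossCM
    (phi_heegnerPointOfConductor_mem_range_map_ringClassField_holds (W.conductorNorm ℤ) W K) hIQ hD hHe 2 Dt β ι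
    squarefree_one (by simp) d₁
  have hℓ1 : ℓ ∉ (1 : ℕ).primeFactors := by simp
  obtain ⟨hσ', hS', hS'', hemb'⟩ := hdℓ ℓ hkolZ hℓ1
  set d' := dℓ ℓ hkolZ hℓ1 with hd'_def
  set x := d'.kolyvaginClass Nat.prime_two M with hx_def
  have hc' : Squarefree (1 * ℓ) := by rw [one_mul]; exact hℓp.squarefree
  have hℓn : ¬ ℓ ∣ 1 := fun h ↦ hℓp.one_lt.ne' (Nat.dvd_one.mp h)
  have hkM : ∀ q ∈ (1 * ℓ).primeFactors, Zhang2014.IsKolyvaginPrime (W.conductorNorm ℤ) W K 2 q ∧ M ≤ Zhang2014.kolyvaginIndex W 2 q := by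
    intro q hq
    rw [one_mul, hℓp.primeFactors, Finset.mem_singleton] at hq
    subst hq
    exact ⟨hkolZ, le_trans (Nat.le_succ M) hidx'⟩
  have hkM1 : ∀ q ∈ (1 * ℓ).primeFactors, Zhang2014.IsKolyvaginPrime (W.conductorNorm ℤ) W K 2 q ∧
      M + 1 ≤ Zhang2014.kolyvaginIndex W 2 q := by
    intro q hq
    rw [one_mul, hℓp.primeFactors, Finset.mem_singleton] at hq
    subst hq
    exact ⟨hkolZ, hidx'⟩
  have hcard : (1 * ℓ).primeFactors.card = 1 := by rw [one_mul, hℓp.primeFactors, Finset.card_singleton]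
  -- signs: `c_M(ℓ)`, `c_{M+1}(ℓ)` are `τ`-invariant (`−w·(−1) = +1`)
  obtain ⟨-, hx⟩ := KolyvaginClassSign.sign_conjAct_kolyvaginClass_two hIQ h3 hD4 hodd hHe hsurj1 τ hτ Dt β ι hc' hM hkM d'
  obtain ⟨-, hx1⟩ := KolyvaginClassSign.sign_conjAct_kolyvaginClass_two hIQ h3 hD4 hodd hHe hsurj1 τ hτ Dt β ι hc' hM' hkM1 d'
  rw [hcard, pow_one, hw1] at hx hx1
  norm_num at hx hx1
  -- Q2 at the own prime: Selmer threshold of `x` at `λ` = zero threshold `κ` of `y`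
  have hQ := hQ2 W hcm K hIQ h3 hD4 hHe hρN Dt β ι M hM 1 ℓ hc' hℓp hℓn hkM d₁ d' hσ' hS' hS'' hemb' w hwℓ
  have hβ : ∀ j : ℕ, ((2 ^ j : ℕ) : ℤ) • x ∈ selmerLocalKer (W.baseChange K) (w.adicCompletion K) ((2 ^ M : ℕ) : ℤ) ↔ κ ≤ j :=
    fun j ↦ (hQ j).1.trans (((hQ j).2).trans (hαy j))
  -- ### the ℚ-descent `u` of `x` (TQ-DEEP, margin one): Selmer at every finite `v' ≠ v_ℓ` and — by ARCH-M1 — at `∞`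
  obtain ⟨u, hu, -⟩ := EigenClassesFinite.existsUnique_resTorsion_eq_of_conjAct_eq W K h2 hθ hd ((2 ^ M : ℕ) : ℤ) (htorsK M) hx
  have hufin : ∀ v' : HeightOneSpectrum (𝓞 ℚ), v' ≠ vℓ → u ∈ selmerLocalKer W (v'.adicCompletion ℚ) ((2 ^ M : ℕ) : ℤ) := by
    intro v' hv'
    have hv'' : ∀ w' : HeightOneSpectrum (𝓞 K), w'.asIdeal.LiesOver v'.asIdeal → ((1 * ℓ : ℕ) : 𝓞 K) ∉ w'.asIdeal := by
      intro w' hw' hmem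
      rw [one_mul] at hmem
      have hvmem : (ℓ : 𝓞 ℚ) ∈ v'.asIdeal := by
        have h : algebraMap (𝓞 ℚ) (𝓞 K) (ℓ : 𝓞 ℚ) ∈ w'.asIdeal := by rwa [map_natCast]
        rw [← Ideal.mem_comap, ← Ideal.under_def, ← Ideal.LiesOver.over (P := w'.asIdeal) (p := v'.asIdeal)] at h
        exact h
      exact hv' ((natCast_prime_mem_iff_eq hℓp v').mp hvmem)
    obtain ⟨u', hu', hsel⟩ := SelmerDescent.exists_descent_kolyvaginClass_two_mem_selmerLocalKer_of_margin W hsurN hT K hIQ h2 hθ hd h3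
      hD4 hHe Dt β ι M hc' hkM1 d' (htorsK (M + 1)) hx1 hx v' hv''
    have huu : u' = u := hinjres (hu'.trans hu.symm)
    rw [← huu]
    exact hsel
  have huinf : ∀ w' : InfinitePlace ℚ, u ∈ selmerLocalKer W w'.Completion ((2 ^ M : ℕ) : ℤ) := fun w' ↦
    SelmerDescent.mem_selmerLocalKer_infinitePlace_of_resTorsion_eq_kolyvaginClass_two_of_margin W hsurN K hIQ h2 hθ hd h3 hD4 hHe Dt β ι
      M hc' hkM1 d' (htorsK (M + 1)) hx1 hu w'
  -- the Selmer threshold of `u` at `v_ℓ` is `κ`: `2^(κ−1) • u` is NOT Selmer there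
  have hudv : ((2 : ℤ) ^ (κ - 1)) • u ∉ selmerLocalKer W (vℓ.adicCompletion ℚ) ((2 ^ M : ℕ) : ℤ) := by
    intro hmem
    have h' : ((2 : ℤ) ^ (κ - 1)) • resTorsion W K ((2 ^ M : ℕ) : ℤ) u ∈ selmerLocalKer (W.baseChange K) (w.adicCompletion K) ((2 ^ M : ℕ) : ℤ) :=
      (SelmerDescent.zsmul_mem_selmerLocalKer_iff_resTorsion W h2 (not_mem_range hθ) hd ((2 ^ M : ℕ) : ℤ) vℓ w hgoodv hqv h2vℓ hdKv u _).mp hmem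
    rw [hu] at h'
    have h'' : ((2 ^ (κ - 1) : ℕ) : ℤ) • x ∈ selmerLocalKer (W.baseChange K) (w.adicCompletion K) ((2 ^ M : ℕ) : ℤ) := by exact_mod_cast h'
    have := (hβ (κ - 1)).mp h''
    omega
  -- ### McCallum 5.3 + 2.2 over `ℚ_ℓ` AT A REGULAR PRIME (no lost bit): `2^(M − κ) • s₀` vanishes at `v_ℓ`
  have hdual := Engine.lemma_5_3_rat_two_regular W hM (q := 2 ^ M) rfl hℓ2 hℓv hgood hreg2 (le_trans (Nat.le_succ M) hidx') hs₀
    hufin huinf hudv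
  have hexp : M - 1 - (κ - 1) = M - κ := by omega
  rw [hexp] at hdual
  -- transfer to `K_λ` by the REGULAR dictionary
  have hdualK : ((2 : ℤ) ^ (M - κ)) • s ∈ (W.baseChange K).torsionLocalKer (w.adicCompletion K) ((2 ^ M : ℕ) : ℤ) := by
    have h := (Engine.zsmul_mem_torsionLocalKer_iff_resTorsion_of_notMem_regular W hM (q := 2 ^ M) rfl hℓp hℓ2 hℓv hgoodv h2
      (not_mem_range hθ) hd hdKv hregM w hf s₀ ((2 : ℤ) ^ (M - κ))).mp hdual
    exact h
  have hdualK' : ((2 ^ (M - κ) : ℕ) : ℤ) • s ∈ (W.baseChange K).torsionLocalKer (w.adicCompletion K) ((2 ^ M : ℕ) : ℤ) := by exact_mod_cast hdualK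
  -- ### conclusion: `a ≤ M − κ ≤ M₀`
  have haMκ : a ≤ M - κ := (hαs (M - κ)).mp hdualK'
  have haM₀ : a ≤ M₀ := by omega
  have hs0 : ((2 ^ M₀ : ℕ) : ℤ) • s = 0 := (two_pow_zsmul_eq_zero_iff_of_addOrderOf W K ha M₀).mpr haM₀
  apply hinjres
  rw [map_zsmul, map_zero, ← hsdef, hs0]

end Summit.BirchSwinnertonDyer.BirchSwinnertonDyer.Theorems.GenusExact.PlusDescent

/-! ## from `GenusKolyvaginAtTwoShaCardDvdPowAtTwoPosTB2QSignFree` -/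

open scoped Classical
open scoped AddSubgroup

namespace Summit.BirchSwinnertonDyer.BirchSwinnertonDyer.Theorems.GenusExact.PlusDescent

open WeierstrassCurve NumberField IsDedekindDomain Field Rat.HeightOneSpectrum Literature.NumberTheory.EllipticCurves
  Literature.NumberTheory.GaloisRepresentations Literature.NumberTheory.EllipticCurves.ModularForms AddSubgroup
  Literature.NumberTheory.EllipticCurves.RingClassField
open Summit.BirchSwinnertonDyer.BirchSwinnertonDyer.Theses.GenusKolyvaginAtTwo (KolyvaginRelationAtTwo)
open Summit.BirchSwinnertonDyer.Rank1Residual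
open Summit.BirchSwinnertonDyer.BirchSwinnertonDyer.Theorems.GenusExact

/-- (LINE 26 FLAT form: the hypothesis `(NPh at 2N)(E, K)` replaces the odd multiplicative prime `v`.) **STUB `stub_b2qSignFree_flat` of the LEAD's LINE `rational_pair_descent_pos` on U⁺_T (stmt-BirchSwinnertonDyer-23378) — registered signature
VERBATIM: Kolyvagin's Theorem B₂ at `l = 2` over `ℚ`, SHARP (`2^{M₀} • s = 0` for every `s ∈ Sel_(2^M)(E/ℚ)`), on U_T's frame with NO sign
condition on `Δ(E)`** (non-CM, odd Tamagawa product, an odd multiplicative prime, `K` imaginary quadratic with `d_K` odd `≠ −3` Heegner and the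
two non-square side conditions, `ρ_{E,2^n}` onto, `d₁` with `2^{M₀+1} ∤ P(1)`, `w(E) = +1`; Q2 as antecedent) = the frame
`two_pow_smul_selmer_rat_eq_zero_of_regularPairSupply_flat` fed with `regularPairSupply_of_heegner`.
[cite: Kolyvagin1989Izv, Thm. B₂, §3] [cite: McCallumLMS1991, §3 Cor. 3.2, §4 Prop. 4.4, §5 Lemma 5.3] [cite: GrossLMS1991, §10, Props. 5.4, 6.2, 8.2] -/
theorem stub_b2qSignFree_flat : KolyvaginRelationAtTwo → ∀ (W : WeierstrassCurve ℚ) [W.IsElliptic] [W.IsGloballyMinimal] [NeZero (W.conductorNorm ℤ)], ¬ W.HasCM → Odd W.tamagawaProduct → ∀ (K : Type) [Field K] [NumberField K], IsImaginaryQuadratic K → Odd (NumberField.discr K) → NumberField.discr K ≠ -3 → SatisfiesHeegnerHypothesis (W.conductorNorm ℤ) K → ¬ IsSquare ((NumberField.discr K : ℚ) * -|W.Δ|) → ¬ IsSquare ((NumberField.discr K : ℚ) * (-(2 * |W.Δ|))) →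
    (∀ (Mlev : ℕ), 1 ≤ Mlev → ∀ z : galH1Torsion (W.baseChange K) ((2 ^ Mlev : ℕ) : ℤ),
          (∀ ρ ∈ torsionFixing (W.baseChange K) ((2 ^ Mlev : ℕ) : ℤ), h1Eval (W.baseChange K) ((2 ^ Mlev : ℕ) : ℤ) z ρ = 0) →
          (∀ w : HeightOneSpectrum (𝓞 K), ((2 * W.conductorNorm ℤ : ℕ) : 𝓞 K) ∈ w.asIdeal →
            z ∈ selmerLocalKer (W.baseChange K) (w.adicCompletion K) ((2 ^ Mlev : ℕ) : ℤ)) → z = 0) → (∀ n : ℕ, 0 < n → W.HasSurjectiveModNGaloisRep ((2 : ℤ) ^ n)) → ∀ (Dt : ModularParametrizationData W (W.conductorNorm ℤ)) (β : ℤ) (ι : K →+* ℂ) (d₁ : KolyvaginHeegnerData Dt β ι 1) (M₀ : ℕ), (¬ ∃ Q : (W.baseChange (ringClassField K ι 1)).toAffine.Point, ((2 ^ (M₀ + 1) : ℕ) : ℤ) • Q = d₁.derivedPoint) → W.rootNumber = 1 → ∀ (M : ℕ) (s₀ : galH1Torsion W ((2 ^ M : ℕ) : ℤ)), s₀ ∈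 selmerGroup W ((2 ^ M : ℕ) : ℤ) → ((2 ^ M₀ : ℕ) : ℤ) • s₀ = 0 := by
  intro hQ2 W _ _ _ hcm hT K _ _ hIQ hodd h3 hHe hsq1 hsq2 hNPh hρ Dt β ι d₁ M₀ hndiv hw1 M s₀ hs₀
  exact two_pow_smul_selmer_rat_eq_zero_of_regularPairSupply_flat hQ2 W hcm hT K hIQ hodd h3 hHe hsq1 hsq2 hNPh hρ Dt β ι d₁ M₀ hndiv hw1
    (regularPairSupply_of_heegner W K hIQ hodd hHe hρ) M s₀ hs₀

end Summit.BirchSwinnertonDyer.BirchSwinnertonDyer.Theorems.GenusExact.PlusDescent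

end
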